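import Mathlib

/-!
# Traces of the members outside `u`: Lemma A and the lift (Addendum 39, Steps 1 and 3)

Dossier proofs/MINE1-theoremS.md, Addendum 39 (Lemma A of supplement 1, Step 3), and
proofs/MINE1-RSTARM-PROOF.md §1 (Lemma A), §6. Finite set algebra on the instance data:

* `union_sdiff_mem_of_subset_inter` (**Lemma A**): a member `k ⊆ u` below the trace `y ∩ u` of a
  member `y` has `k ∪ (y \ u) ∈ T` (it lies between `k ∈ U` and `y`, and `T = U ∩ ↓T`); so the
  members of `T` inside `u` below an outside trace are themselves outside traces,
  `K⁺ = T_u ∩ P^out`.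
* `exists_mem_inter_of_trace_sdiff_mem` (**the lift**): if the trace `t = y ∩ u` of a member has
  `u \ t ∈ U` (i.e. `t` lies in the link `Λ`) and (S1) holds, then `u \ t` is a member of `T` lying
  in `L'` — a witness. Hence in a witness-free instance no trace lies in `Λ`, which is what lifts a
  witness of the merged instance to `T`.
* `not_sdiff_subset_of_subset_of_not_sdiff_subset` (**(1c)**): `u \ ρ ⊆ t` is impossible as soon as
  `u \ ρ_m ⊆ t` is impossible for some `ρ_m ⊇ ρ` — with `ρ = ρ^* = ⋂_m ρ_m` this is «`W^*` lies
  below no outside trace».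
-/

namespace PercRepro.MSTight

open Finset

variable {α : Type*} [DecidableEq α]

/-- **Lemma A.** A member `k ⊆ u` below the trace of a member `y` is the trace of the member
`k ∪ (y \ u)`. -/
theorem union_sdiff_mem_of_subset_inter {U T : Finset (Finset α)} {u k y : Finset α}
    (hU : ∀ x ∈ U, ∀ x', x ⊆ x' → x' ∈ U) (hTU : T ⊆ U)
    (hF2 : ∀ x ∈ U, (∃ t ∈ T, x ⊆ t) → x ∈ T)
    (hk : k ∈ T) (hy : y ∈ T) (hky : k ⊆ y ∩ u) : k ∪ (y \ u) ∈ T := by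
  refine hF2 _ (hU k (hTU hk) _ subset_union_left) ⟨y, hy, ?_⟩
  intro a ha
  rcases mem_union.1 ha with h | h
  · exact (mem_inter.1 (hky h)).1
  · exact (mem_sdiff.1 h).1

/-- **The lift.** If the trace `t = y ∩ u` of a member `y` has `u \ t ∈ U` and every member of `U`
strictly inside `u` is a member of `T` ((S1)), then `u \ t` is a witness. -/
theorem exists_mem_inter_of_trace_sdiff_mem [Fintype α] {L' U T : Finset (Finset α)}
    {u y : Finset α} (hL : ∀ w ∈ L', ∀ w', w' ⊆ w → w' ∈ L') (hUL : ∀ x ∈ U, univ \ x ∈ L')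
    (hTU : T ⊆ U) (hS1 : ∀ x ∈ U, x ⊆ u → x ≠ u → x ∈ T) (hy : y ∈ T) (hyu : (y ∩ u).Nonempty)
    (ht : u \ (y ∩ u) ∈ U) : ∃ w ∈ T, w ∈ L' := by
  refine ⟨u \ (y ∩ u), hS1 _ ht sdiff_subset ?_, ?_⟩
  · intro h
    obtain ⟨a, ha⟩ := hyu
    have : a ∈ u \ (y ∩ u) := by rw [h]; exact (mem_inter.1 ha).2
    exact (mem_sdiff.1 this).2 ha
  · refine hL _ (hUL y (hTU hy)) _ ?_
    intro a ha
    rw [mem_sdiff] at ha ⊢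
    exact ⟨mem_univ a, fun hay => ha.2 (mem_inter.2 ⟨hay, ha.1⟩)⟩

/-- **(1c).** `u \ ρ ⊆ t` is impossible when `u \ ρ' ⊆ t` is impossible for some `ρ' ⊇ ρ`. -/
theorem not_sdiff_subset_of_subset_of_not_sdiff_subset {u ρ ρ' t : Finset α} (hρ : ρ ⊆ ρ')
    (h : ¬ u \ ρ' ⊆ t) : ¬ u \ ρ ⊆ t := by
  intro hsub
  exact h (fun a ha => hsub (mem_sdiff.2 ⟨(mem_sdiff.1 ha).1, fun hρa => (mem_sdiff.1 ha).2 (hρ hρa)⟩))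

end PercRepro.MSTight
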